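import Summits.ResolutionOfSingularities.ResolutionOfSingularities.Theorems.EquisingularLiftEquisingularLiftNatResidueHypDefsND
import Summits.ResolutionOfSingularities.ResolutionOfSingularities.Theorems.EquisingularLiftEquisingularLiftNatModelStepChain
import Literature.AlgebraicGeometry.Resolution.StrictTransformDistinct
import Literature.AlgebraicGeometry.Resolution.BlowupsExistence
import HarnessLib

/-!
# [OURS · L1 W4.5(b) · EL♮(3)] ND STRATA TOWERS — `…NatNDStrataTower` (desk R31 (β) DEAL «ND-K5», hand (D) = the PORT): boundaries indexed by rays, strata,
# `StrataTower`, `ReachToric` (§13.1), their certified small print (§13.5), the O-side ITERATION `strataTower_lift` PROVED from ANY upstairs invariant with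
# `StratumFacts`/`StepFacts` (§13.6), and the k-side ITERATION `rounds_resolve` / `hres_of_rounds` PROVED from ANY downstairs invariant with `RoundFacts` (§13.9)

OURS · L1 W4.5(b) · EL♮(3) stmt-ResolutionOfSingularities-20148 (parent EL♮ stmt-…-20038) · counted 0 · AI-written (res-L1-w45b-idea-1 g23 SPEC
`Cruxes/EquisingularLiftNatThree/NewtonNondegenerateRungK5.lean` v4 sha16 fffe6e12c2da2213 §13.1 / §13.5 / §13.6 / §13.9 VERBATIM; ported to the tree by the text owner
res-L1-w45b-lead-2 g6 per desk R31 (β) (D)), weaker than expert review; nothing of [Hironaka2017] asserted; no statement of the manuscript. Definitions + PROVED pure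
plumbing only (no `sorry`, no instance, no notation; standard axioms). `--supports stmt-ResolutionOfSingularities-20148 --as helper`: support module toward the registered
4th CHILD stub `stub_elnat_three_isolated_newtonNondegenerate` (`IsoHypNDWon → ELNatConclusionO`) — the chain's FIRST BY-NAME CLOSURE TARGET (desk R31 (β)): its rung
`nd_rung_local` = K5′ `target_elnat_of_subchainResolution'` at `Reach := ReachToric n` over (B3) HSUB(ReachToric) = `strataTower_lift` + an upstairs invariant with the
clause bricks (B3a) init (res-type-027) / (B3g) `StratumFacts` (res-L1-w45b-stub-4) / (B3b) `StepFacts` (res-L1-w45b-stub-2), and (B4) `hres` = `hres_of_rounds` + a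
downstairs invariant with (B4-init)/(B4-round) (idea-1 ROUND 10 split, provers per desk). Bricks close BY NAME against THESE declarations (namespace `…Sections.ND`,
names = the spec's). NOT ported (sorried signatures / candidates, stay in the Cruxes spec): §13.2/§13.3 (B3)/(B4) signatures, §13.7 `SNCInv`, §13.8 the rung, §13.10
`NDInv`, §13.11.
-/

set_option linter.dupNamespace false

noncomputable section

open CategoryTheory CategoryTheory.Limits AlgebraicGeometry TopologicalSpace Topology
open MvPolynomial
open Literature.AlgebraicGeometry.Resolution
open AlgebraicGeometry.Scheme.IdealSheafData

namespace Summit.ResolutionOfSingularities.ResolutionOfSingularities.Cruxes.EquisingularLiftNat.Sections.ND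

open Summit.ResolutionOfSingularities.ResolutionOfSingularities.Cruxes.EquisingularLiftNat.Sections

/-! ## 13.1 Boundaries indexed by rays, strata, strata towers, `ReachToric` -/

/-- A BOUNDARY on `F` indexed by rays of `ℤⁿ`: one ideal sheaf per ray (the value at a ray that is «not present» is `⊤`, the empty divisor).
[OURS · L1 W4.5b · definition] -/
abbrev Boundary (n : ℕ) (F : Scheme.{0}) : Type := Ray n → F.IdealSheafData

variable {n : ℕ}

/-- The STRATUM (closed-orbit analogue) of a face `τ`: the sum of the ideals of its rays, `V(τ.sup E) = ⋂_{ρ ∈ τ} V(E ρ)`.  [OURS · definition] -/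
def stratum {F : Scheme.{0}} (E : Boundary n F) (τ : Finset (Ray n)) : F.IdealSheafData := τ.sup E

/-- One step of the boundary: after blowing up `C` (by `υ`), the NEW ray `ν` carries the exceptional divisor `C·𝒪_{F'}`, every other ray the STRICT
transform of its divisor (Görtz–Wedhorn (13.19), `Literature…strictTransformIdeal`).  [OURS · definition] -/
def Boundary.stepAlong {F F' : Scheme.{0}} (E : Boundary n F) (C : F.IdealSheafData) (ν : Ray n) (υ : F' ⟶ F) : Boundary n F' :=
  fun ρ => if ρ = ν then C.comap υ else strictTransformIdeal υ C (E ρ)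

/-- The boundary of a FRAME `W = (W_1, …, W_n)`: the frame ray `e_j` carries `W_j`, every other ray `⊤`.  [OURS · definition] -/
def frameBoundary {F : Scheme.{0}} (W : Fin n → F.IdealSheafData) : Boundary n F :=
  fun ρ => (Finset.univ.filter (fun j => e n j = ρ)).inf W

/-- `W` is a FRAME AT `x`: the stalks `(W_j)_x` are principal, generated by a regular system of parameters `w_1, …, w_n` of the `n`-dimensional local ring
`𝒪_{F,x}` (so `𝒪_{F,x}` is regular and `V(W_1), …, V(W_n)` are SNC divisors through `x` cutting out `x`).  Chart-free; the étale chart `(w_j) : Spec 𝒪_{F,x} → 𝔸ⁿ`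
is DERIVED by the provers, not posited.  [OURS · definition] -/
def IsFrameAt {F : Scheme.{0}} (W : Fin n → F.IdealSheafData) (x : F) : Prop :=
  ∃ w : Fin n → F.presheaf.stalk x, (∀ j, stalkIdeal (W j) x = Ideal.span {w j}) ∧
    Ideal.span (Set.range w) = IsLocalRing.maximalIdeal (F.presheaf.stalk x) ∧
    ringKrullDim (F.presheaf.stalk x) = (n : WithBot ℕ∞)

/-- **STRATA TOWERS.**  `StrataTower F E T F₉ β T₉`: `(F₉, β : F₉ ⟶ F, T₉)` is obtained from `(F, E, T)` by finitely many steps «choose a face `τ` with a NON-FRAME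
ray whose stratum is E1-LEGAL for the current strict transform `T` (`supp ⊆ T`, `T ⊄ supp`), blow the stratum up, replace `E` by `E.stepAlong (stratum E τ) (Σ τ)`
and `T` by the strict transform `closure (υ⁻¹(T ∖ supp))`».  No fan, no equation: legality is carried as DATA (the k-side proves it from `Bad`, the O-side consumes
it).  [OURS · definition] -/
inductive StrataTower : ∀ (F : Scheme.{0}), Boundary n F → Set F → ∀ (F₉ : Scheme.{0}), (F₉ ⟶ F) → Set F₉ → Prop
  | nil (F : Scheme.{0}) (E : Boundary n F) (T : Set F) : StrataTower F E T F (𝟙 F) T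
  | cons (F : Scheme.{0}) (E : Boundary n F) (T : Set F) (τ : Finset (Ray n))
      (hτ : ∃ ρ ∈ τ, ρ ∉ Set.range (e n))
      (hE1 : ((stratum E τ).support : Set F) ⊆ T) (hT : ¬ T ⊆ ((stratum E τ).support : Set F))
      (F' : Scheme.{0}) (υ : F' ⟶ F) (hυ : IsBlowup υ (stratum E τ))
      (F₉ : Scheme.{0}) (β : F₉ ⟶ F') (T₉ : Set F₉) :
      StrataTower F' (E.stepAlong (stratum E τ) (∑ ρ ∈ τ, ρ) υ) (closure (υ ⁻¹' (T \ ((stratum E τ).support : Set F)))) F₉ β T₉ →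
      StrataTower F E T F₉ (β ≫ υ) T₉

/-- **`ReachToric n`** — the admissibility predicate fed to K5′ (`Reach` slot, same type): after the point blow-up `υ : F₂ ⟶ F₁` of the closed point `x`,
`(F₉, β, T₉)` is a STRATA TOWER over `(F₂, E₁, T₂)` where `E₁` = the frame boundary of some frame `W` at `x`, stepped along the point blow-up (the ray
`𝟙 = Σ_j e_j` carries the exceptional divisor `𝔪_x·𝒪_{F₂}`, the ray `e_j` the strict transform of `W_j`).  [OURS · definition] -/
def ReachToric (n : ℕ) : ∀ (F₁ F₂ : Scheme.{0}), (F₂ ⟶ F₁) → F₁ → Set F₂ → ∀ (F₉ : Scheme.{0}), (F₉ ⟶ F₂) → Set F₉ → Prop :=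
  fun F₁ F₂ υ x T₂ F₉ β T₉ => ∃ (hx : IsClosed ({x} : Set F₁)) (W : Fin n → F₁.IdealSheafData), IsFrameAt W x ∧
    StrataTower F₂ ((frameBoundary W).stepAlong (vanishingIdeal (⟨{x}, hx⟩ : Closeds F₁)) 1 υ) T₂ F₉ β T₉

/-! ## 13.5 Certified small print of the definitions -/

/-- The ray `𝟙 = (1, …, 1)` is the sum of the frame rays (the exceptional ray of the POINT blow-up = the star of the full orthant cone). [OURS] -/
theorem one_eq_sum_e : (1 : Ray n) = ∑ j : Fin n, e n j := by
  funext i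
  simp [e, Finset.sum_apply, Pi.single_apply]

/-- The frame boundary at a frame ray is the frame member. [OURS] -/
theorem frameBoundary_e {F : Scheme.{0}} (W : Fin n → F.IdealSheafData) (j : Fin n) : frameBoundary W (e n j) = W j := by
  have hinj : Function.Injective (e n) := fun a b h => by
    by_contra hab
    have := congrFun h a
    simp [e, hab] at this
  have : (Finset.univ.filter (fun i => e n i = e n j)) = {j} := by
    ext i; simp [hinj.eq_iff]
  simp [frameBoundary, this]

/-- The frame boundary at a non-frame ray is `⊤` (no divisor). [OURS] -/
theorem frameBoundary_of_not_mem_range {F : Scheme.{0}} (W : Fin n → F.IdealSheafData) {ρ : Ray n} (hρ : ρ ∉ Set.range (e n)) :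
    frameBoundary W ρ = ⊤ := by
  have : (Finset.univ.filter (fun i => e n i = ρ)) = ∅ := by
    ext i; simp only [Finset.mem_filter, Finset.mem_univ, true_and, Finset.notMem_empty, iff_false]
    exact fun h => hρ ⟨i, h⟩
  simp [frameBoundary, this]

/-- `stepAlong` at the new ray is the exceptional ideal, elsewhere the strict transform. [OURS] -/
theorem stepAlong_self {F F' : Scheme.{0}} (E : Boundary n F) (C : F.IdealSheafData) (ν : Ray n) (υ : F' ⟶ F) :
    E.stepAlong C ν υ ν = C.comap υ := by simp [Boundary.stepAlong]

/-- `stepAlong` at a ray other than the new one is the strict transform of that ray's divisor. [OURS] -/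
theorem stepAlong_of_ne {F F' : Scheme.{0}} (E : Boundary n F) (C : F.IdealSheafData) {ν ρ : Ray n} (h : ρ ≠ ν) (υ : F' ⟶ F) :
    E.stepAlong C ν υ ρ = strictTransformIdeal υ C (E ρ) := by simp [Boundary.stepAlong, h]

/-- A ray absent before a step (value `⊤`) and different from the new ray stays absent. [OURS; `strictTransformIdeal_top`] -/
theorem stepAlong_eq_top {F F' : Scheme.{0}} (E : Boundary n F) (C : F.IdealSheafData) {ν ρ : Ray n} (h : ρ ≠ ν) (υ : F' ⟶ F)
    (hρ : E ρ = ⊤) : E.stepAlong C ν υ ρ = ⊤ := by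
  rw [stepAlong_of_ne E C h υ, hρ, strictTransformIdeal_top]

/-- The identity tower is admissible (zero steps). [OURS] -/
theorem strataTower_nil {F : Scheme.{0}} (E : Boundary n F) (T : Set F) : StrataTower F E T F (𝟙 F) T := StrataTower.nil F E T

/-! ## 13.6 (B3c) THE ITERATION, PROVED: HSUB(ReachToric) from ANY upstairs invariant `G` with (B3a) an initialisation at the point step, (B3g) the four
centre facts for every stratum with a non-frame ray, (B3b) preservation under one strata step — by induction over `StrataTower` with `modelStep_chain` -/

section Iteration

/-- The STAGE TUPLE `modelStep_chain` consumes and produces, for a downstairs `(F, T)` modelled by `jm : F ⟶ X` in the stage `(X, σ, S)`. [OURS · abbreviation] -/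
def StageTuple (O : Type) [CommRing O] (k : Type) [Field k] (θ : O →+* k) (P : Scheme.{0}) (q : P ⟶ Spec (.of O))
    (Ch : ∀ X' : Scheme.{0}, (X' ⟶ P) → Set X' → Prop)
    (X : Scheme.{0}) (σ : X ⟶ P) (S : Set X) (F : Scheme.{0}) (jm : F ⟶ X) (t : F ⟶ Spec (.of k)) (T : Set F) : Prop :=
  Ch X σ S ∧ IsIntegral X ∧ IsLocallyNoetherian X ∧ Scheme.IsRegular X ∧ IsDominant (σ ≫ q) ∧ IsIntegral F ∧
    IsPullback jm t (σ ≫ q) (Spec.map (CommRingCat.ofHom θ)) ∧ jm '' T = S ∧ IsClosed T ∧ IsIrreducible T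

variable (O : Type) [CommRing O] [IsDomain O] [IsDiscreteValuationRing O] (k : Type) [Field k] (θ : O →+* k)
  (P : Scheme.{0}) (q : P ⟶ Spec (.of O)) (Y : Set P) (Ch : ∀ X' : Scheme.{0}, (X' ⟶ P) → Set X' → Prop)

/-- **(B3g) as a predicate on `G`**: at every stage, every stratum of a face with a non-frame ray whose downstairs stratum is E1-legal is, upstairs, a REGULAR,
`O`-FLAT centre with `comap jm = ` the downstairs stratum and off the generic point of `Y`.  [OURS · the centre-facts clause of the spec] -/
def StratumFacts (G : ∀ (X : Scheme.{0}) (_ : X ⟶ P) (F : Scheme.{0}) (_ : F ⟶ X), Boundary n X → Boundary n F → Prop) : Prop :=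
  ∀ (X : Scheme.{0}) (σ : X ⟶ P) (S : Set X) (F : Scheme.{0}) (jm : F ⟶ X) (t : F ⟶ Spec (.of k)) (T : Set F)
    (EX : Boundary n X) (E : Boundary n F), StageTuple O k θ P q Ch X σ S F jm t T → G X σ F jm EX E →
    ∀ τ : Finset (Ray n), (∃ ρ ∈ τ, ρ ∉ Set.range (e n)) → ((stratum E τ).support : Set F) ⊆ T →
      Scheme.IsRegular (stratum EX τ).subscheme ∧ Flat ((stratum EX τ).subschemeι ≫ σ ≫ q) ∧
      (stratum EX τ).comap jm = stratum E τ ∧ σ '' ((stratum EX τ).support : Set X) ⊆ {y : P | ¬ IsGenericPoint y Y}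

/-- **(B3b) as a predicate on `G`**: `G` survives one strata step (upstairs blow-up `τX` of the upstairs stratum, downstairs blow-up `υ` of the downstairs
stratum, the new model square `j'` with `j' ≫ τX = υ ≫ jm` produced by `modelStep_chain`), the boundaries being stepped along on both floors. [OURS · the
step clause of the spec] -/
def StepFacts (G : ∀ (X : Scheme.{0}) (_ : X ⟶ P) (F : Scheme.{0}) (_ : F ⟶ X), Boundary n X → Boundary n F → Prop) : Prop :=
  ∀ (X : Scheme.{0}) (σ : X ⟶ P) (S : Set X) (F : Scheme.{0}) (jm : F ⟶ X) (t : F ⟶ Spec (.of k)) (T : Set F)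
    (EX : Boundary n X) (E : Boundary n F), StageTuple O k θ P q Ch X σ S F jm t T → G X σ F jm EX E →
    ∀ τ : Finset (Ray n), (∃ ρ ∈ τ, ρ ∉ Set.range (e n)) → ((stratum E τ).support : Set F) ⊆ T → ¬ T ⊆ ((stratum E τ).support : Set F) →
    ∀ (X₂ : Scheme.{0}) (τX : X₂ ⟶ X), IsBlowup τX (stratum EX τ) → IsIntegral X₂ → IsLocallyNoetherian X₂ → Scheme.IsRegular X₂ →
    ∀ (F₂ : Scheme.{0}) (υ : F₂ ⟶ F), IsBlowup υ (stratum E τ) → IsIntegral F₂ →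
    ∀ (j' : F₂ ⟶ X₂) (t' : F₂ ⟶ Spec (.of k)), IsPullback j' t' ((τX ≫ σ) ≫ q) (Spec.map (CommRingCat.ofHom θ)) → j' ≫ τX = υ ≫ jm →
      G X₂ (τX ≫ σ) F₂ j' (EX.stepAlong (stratum EX τ) (∑ ρ ∈ τ, ρ) τX) (E.stepAlong (stratum E τ) (∑ ρ ∈ τ, ρ) υ)

/-- **The induction over strata towers** (engine context fixed): a `G`-good stage over `(F, E, T)` lifts every strata tower over `(F, E, T)`.
[OURS · L1 W4.5b · PROVED; `modelStep_chain` + `exists_isBlowup`] -/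
theorem strataTower_lift (hθ : Function.Surjective θ) (hYirr : IsIrreducible Y) (hYcl : IsClosed Y)
    (hChain : ∀ (X' : Scheme.{0}) (σ : X' ⟶ P) (S : Set X'), Ch X' σ S →
      Summit.ResolutionOfSingularities.ResolutionOfSingularities.Theses.EquisingularLift.Split.Chain P Y X' σ S)
    (hStep : ∀ (X' X'' : Scheme.{0}) (σ' : X' ⟶ P) (S' : Set X') (C : X'.IdealSheafData) (τ : X'' ⟶ X'),
      Ch X' σ' S' → IsBlowup τ C → Scheme.IsRegular C.subscheme → Flat (C.subschemeι ≫ σ' ≫ q) →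
      σ' '' (C.support : Set X') ⊆ {x : P | ¬ IsGenericPoint x Y} →
      (C.support : Set X') ∩ (σ' ≫ q) ⁻¹' {IsLocalRing.closedPoint O} ⊆ S' →
      Ch X'' (τ ≫ σ') (closure (τ ⁻¹' (S' \ (C.support : Set X')))))
    (G : ∀ (X : Scheme.{0}) (_ : X ⟶ P) (F : Scheme.{0}) (_ : F ⟶ X), Boundary n X → Boundary n F → Prop)
    (hstrat : StratumFacts (n := n) O k θ P q Y Ch G) (hstep : StepFacts (n := n) O k θ P q Ch G)
    {F : Scheme.{0}} {E : Boundary n F} {T : Set F} {F₉ : Scheme.{0}} {β : F₉ ⟶ F} {T₉ : Set F₉}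
    (h : StrataTower F E T F₉ β T₉) :
    ∀ (X : Scheme.{0}) (σ : X ⟶ P) (S : Set X) (jm : F ⟶ X) (t : F ⟶ Spec (.of k)) (EX : Boundary n X),
      StageTuple O k θ P q Ch X σ S F jm t T → G X σ F jm EX E →
      ∃ (X₉ : Scheme.{0}) (σ₉ : X₉ ⟶ P) (S₉ : Set X₉) (j₉ : F₉ ⟶ X₉) (t₉ : F₉ ⟶ Spec (.of k)),
        Ch X₉ σ₉ S₉ ∧ IsIntegral X₉ ∧ IsLocallyNoetherian X₉ ∧ Scheme.IsRegular X₉ ∧ IsDominant (σ₉ ≫ q) ∧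
        IsPullback j₉ t₉ (σ₉ ≫ q) (Spec.map (CommRingCat.ofHom θ)) ∧ j₉ '' T₉ = S₉ ∧
        IsClosed T₉ ∧ IsIrreducible T₉ ∧ IsIntegral F₉ := by
  induction h with
  | nil F E T =>
    intro X σ S jm t EX hst _
    obtain ⟨hCh, hXi, hXn, hXr, hdom, hFi, hsq, hTS, hTcl, hTirr⟩ := hst
    exact ⟨X, σ, S, jm, t, hCh, hXi, hXn, hXr, hdom, hsq, hTS, hTcl, hTirr, hFi⟩
  | cons F E T τ hτ hE1 hT F' υ hυ F₉ β T₉ hrest ih =>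
    intro X σ S jm t EX hst hG
    obtain ⟨hCh, hXi, hXn, hXr, hdom, hFi, hsq, hTS, hTcl, hTirr⟩ := hst
    -- the four centre facts for the upstairs stratum
    obtain ⟨hCreg, hCflat, hCD, hoff⟩ :=
      hstrat X σ S F jm t T EX E ⟨hCh, hXi, hXn, hXr, hdom, hFi, hsq, hTS, hTcl, hTirr⟩ hG τ hτ hE1
    -- blow the upstairs stratum up and run the model step
    obtain ⟨X₂, τX, hτX⟩ := exists_isBlowup X (stratum EX τ)
    haveI := hXi; haveI := hXn; haveI := hFi
    obtain ⟨hX₂i, hX₂n, hX₂r, hX₂dom, hF'i, hirr, j', t', hsq', hcomm, hCh'⟩ :=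
      modelStep_chain O k θ hθ P q Y hYirr hYcl Ch hChain hStep X σ S hCh hXr hdom F jm t hsq T hTS
        (stratum EX τ) (stratum E τ) hCD hCreg hCflat hoff hE1 hT X₂ τX hτX F' υ hυ
    -- the invariant survives the step
    have hG' := hstep X σ S F jm t T EX E ⟨hCh, hXi, hXn, hXr, hdom, hFi, hsq, hTS, hTcl, hTirr⟩ hG τ hτ hE1 hT
      X₂ τX hτX hX₂i hX₂n hX₂r F' υ hυ hF'i j' t' hsq' hcomm
    -- recurse
    obtain ⟨X₉, σ₉, S₉, j₉, t₉, h⟩ := ih X₂ (τX ≫ σ) (j' '' closure (υ ⁻¹' (T \ ((stratum E τ).support : Set F)))) j' t'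
      (EX.stepAlong (stratum EX τ) (∑ ρ ∈ τ, ρ) τX) ⟨hCh', hX₂i, hX₂n, hX₂r, hX₂dom, hF'i, hsq', rfl, isClosed_closure, hirr⟩ hG'
    exact ⟨X₉, σ₉, S₉, j₉, t₉, h⟩

end Iteration

/-! ## 13.9 (B4δ) THE k-SIDE ITERATION, PROVED: `hres`(ReachToric) from ANY downstairs invariant `DI m F ρ T` (m = a termination measure, e.g. the number of
non-regular points of the reduced closure of `T`) with (B4-init) it holds for `(ℙⁿ_k, 𝟙, range ι)`, (B4-end) at `m = 0` the reduced closure is regular,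
(B4-round) at `m + 1` there is a non-regular closed point `x` (ambient regular at `x`) such that after ANY blow-up of `x` some `ReachToric` tower reaches `DI m'`,
`m' ≤ m` — strong induction on `m` through K5′'s closure operator `Q`.  So (B4) `hres_toricRounds` = «exhibit `DI`» (the intended `DI`: §5 of the ENGINE WORD). -/

section Rounds

variable (n : ℕ) (k : Type) [Field k]

/-- K5′'s closure condition on a downstairs predicate `Q` (the inner block of `hres`, VERBATIM): closed under «point step, and every `ReachToric` tower after it».
[OURS · abbreviation] -/
def RoundClosed (Q : ∀ F₁ : AlgebraicGeometry.Scheme.{0}, (F₁ ⟶ (Literature.AlgebraicGeometry.Motives.projectiveSpace n k).left) → Set F₁ → Prop) : Prop :=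
  ∀ (F₁ F₂ : AlgebraicGeometry.Scheme.{0}) (ρ : F₁ ⟶ (Literature.AlgebraicGeometry.Motives.projectiveSpace n k).left)
            (T₁ : Set F₁)
            (x : ↥(AlgebraicGeometry.Scheme.IdealSheafData.vanishingIdeal (⟨closure T₁, isClosed_closure⟩ : TopologicalSpace.Closeds F₁)).subscheme)
            (υ : F₂ ⟶ F₁)
            (hx : IsClosed ({((AlgebraicGeometry.Scheme.IdealSheafData.vanishingIdeal (⟨closure T₁, isClosed_closure⟩ : TopologicalSpace.Closeds F₁)).subschemeι x : F₁)} : Set F₁)),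
          Q F₁ ρ T₁ →
          ¬ IsRegularLocalRing ((AlgebraicGeometry.Scheme.IdealSheafData.vanishingIdeal (⟨closure T₁, isClosed_closure⟩ : TopologicalSpace.Closeds F₁)).subscheme.presheaf.stalk x) →
          IsRegularLocalRing (F₁.presheaf.stalk ((AlgebraicGeometry.Scheme.IdealSheafData.vanishingIdeal (⟨closure T₁, isClosed_closure⟩ : TopologicalSpace.Closeds F₁)).subschemeι x : F₁)) →
          Literature.AlgebraicGeometry.Resolution.IsBlowup υ
            (AlgebraicGeometry.Scheme.IdealSheafData.vanishingIdeal (⟨{((AlgebraicGeometry.Scheme.IdealSheafData.vanishingIdeal (⟨closure T₁, isClosed_closure⟩ : TopologicalSpace.Closeds F₁)).subschemeι x : F₁)}, hx⟩ : TopologicalSpace.Closeds F₁)) →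
          Q F₂ (υ ≫ ρ) (closure (υ ⁻¹' (T₁ \ {((AlgebraicGeometry.Scheme.IdealSheafData.vanishingIdeal (⟨closure T₁, isClosed_closure⟩ : TopologicalSpace.Closeds F₁)).subschemeι x : F₁)}))) ∧
          (∀ (F₉ : AlgebraicGeometry.Scheme.{0}) (β : F₉ ⟶ F₂) (T₉ : Set F₉),
            ReachToric n F₁ F₂ υ ((AlgebraicGeometry.Scheme.IdealSheafData.vanishingIdeal (⟨closure T₁, isClosed_closure⟩ : TopologicalSpace.Closeds F₁)).subschemeι x : F₁) (closure (υ ⁻¹' (T₁ \ {((AlgebraicGeometry.Scheme.IdealSheafData.vanishingIdeal (⟨closure T₁, isClosed_closure⟩ : TopologicalSpace.Closeds F₁)).subschemeι x : F₁)}))) F₉ β T₉ →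
            Q F₉ ((β ≫ υ) ≫ ρ) T₉)

/-- **(B4-round) as a predicate on `DI`**: at measure `m + 1` one round is possible and lowers the measure. [OURS · the round clause of the k-side spec] -/
def RoundFacts (DI : ℕ → ∀ F₁ : AlgebraicGeometry.Scheme.{0}, (F₁ ⟶ (Literature.AlgebraicGeometry.Motives.projectiveSpace n k).left) → Set F₁ → Prop) : Prop :=
  ∀ (m : ℕ) (F₁ : AlgebraicGeometry.Scheme.{0}) (ρ : F₁ ⟶ (Literature.AlgebraicGeometry.Motives.projectiveSpace n k).left) (T₁ : Set F₁), DI (m + 1) F₁ ρ T₁ →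
    ∃ (x : ↥(AlgebraicGeometry.Scheme.IdealSheafData.vanishingIdeal (⟨closure T₁, isClosed_closure⟩ : TopologicalSpace.Closeds F₁)).subscheme) (hx : IsClosed ({((AlgebraicGeometry.Scheme.IdealSheafData.vanishingIdeal (⟨closure T₁, isClosed_closure⟩ : TopologicalSpace.Closeds F₁)).subschemeι x : F₁)} : Set F₁)),
      ¬ IsRegularLocalRing ((AlgebraicGeometry.Scheme.IdealSheafData.vanishingIdeal (⟨closure T₁, isClosed_closure⟩ : TopologicalSpace.Closeds F₁)).subscheme.presheaf.stalk x) ∧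
      IsRegularLocalRing (F₁.presheaf.stalk ((AlgebraicGeometry.Scheme.IdealSheafData.vanishingIdeal (⟨closure T₁, isClosed_closure⟩ : TopologicalSpace.Closeds F₁)).subschemeι x : F₁)) ∧
      ∀ (F₂ : AlgebraicGeometry.Scheme.{0}) (υ : F₂ ⟶ F₁),
        Literature.AlgebraicGeometry.Resolution.IsBlowup υ
          (AlgebraicGeometry.Scheme.IdealSheafData.vanishingIdeal (⟨{((AlgebraicGeometry.Scheme.IdealSheafData.vanishingIdeal (⟨closure T₁, isClosed_closure⟩ : TopologicalSpace.Closeds F₁)).subschemeι x : F₁)}, hx⟩ : TopologicalSpace.Closeds F₁)) →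
        ∃ (F₉ : AlgebraicGeometry.Scheme.{0}) (β : F₉ ⟶ F₂) (T₉ : Set F₉),
          ReachToric n F₁ F₂ υ ((AlgebraicGeometry.Scheme.IdealSheafData.vanishingIdeal (⟨closure T₁, isClosed_closure⟩ : TopologicalSpace.Closeds F₁)).subschemeι x : F₁) (closure (υ ⁻¹' (T₁ \ {((AlgebraicGeometry.Scheme.IdealSheafData.vanishingIdeal (⟨closure T₁, isClosed_closure⟩ : TopologicalSpace.Closeds F₁)).subschemeι x : F₁)}))) F₉ β T₉ ∧
          ∃ m' ≤ m, DI m' F₉ ((β ≫ υ) ≫ ρ) T₉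

/-- **The strong induction over rounds** (any `DI` with end and round clauses): from `DI m F ρ T`, a resolved end `(F', ρ', T')` reachable through every
`RoundClosed` predicate.  [OURS · L1 W4.5b · PROVED; `exists_isBlowup` + logic] -/
theorem rounds_resolve (DI : ℕ → ∀ F₁ : AlgebraicGeometry.Scheme.{0}, (F₁ ⟶ (Literature.AlgebraicGeometry.Motives.projectiveSpace n k).left) → Set F₁ → Prop)
    (hend : ∀ (F₁ : AlgebraicGeometry.Scheme.{0}) (ρ : F₁ ⟶ (Literature.AlgebraicGeometry.Motives.projectiveSpace n k).left) (T₁ : Set F₁), DI 0 F₁ ρ T₁ →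
      Literature.AlgebraicGeometry.Resolution.Scheme.IsRegular (AlgebraicGeometry.Scheme.IdealSheafData.vanishingIdeal (⟨closure T₁, isClosed_closure⟩ : TopologicalSpace.Closeds F₁)).subscheme)
    (hround : RoundFacts n k DI) :
    ∀ (m : ℕ) (F₁ : AlgebraicGeometry.Scheme.{0}) (ρ : F₁ ⟶ (Literature.AlgebraicGeometry.Motives.projectiveSpace n k).left) (T₁ : Set F₁), DI m F₁ ρ T₁ →
      ∃ (F' : AlgebraicGeometry.Scheme.{0}) (ρ' : F' ⟶ (Literature.AlgebraicGeometry.Motives.projectiveSpace n k).left) (T' : Set F'),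
        (∀ Q : (∀ F₁ : AlgebraicGeometry.Scheme.{0}, (F₁ ⟶ (Literature.AlgebraicGeometry.Motives.projectiveSpace n k).left) → Set F₁ → Prop), RoundClosed n k Q → Q F₁ ρ T₁ → Q F' ρ' T') ∧
        Literature.AlgebraicGeometry.Resolution.Scheme.IsRegular (AlgebraicGeometry.Scheme.IdealSheafData.vanishingIdeal
          (⟨closure T', isClosed_closure⟩ : TopologicalSpace.Closeds F')).subscheme := by
  intro m
  induction m using Nat.strong_induction_on with
  | _ m ih =>
    intro F₁ ρ T₁ hDI
    cases m with
    | zero => exact ⟨F₁, ρ, T₁, fun Q _ hQ => hQ, hend F₁ ρ T₁ hDI⟩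
    | succ m =>
      obtain ⟨x, hx, hnreg, hreg, hcont⟩ := hround m F₁ ρ T₁ hDI
      obtain ⟨F₂, υ, hυ⟩ := exists_isBlowup F₁
        (AlgebraicGeometry.Scheme.IdealSheafData.vanishingIdeal (⟨{((AlgebraicGeometry.Scheme.IdealSheafData.vanishingIdeal (⟨closure T₁, isClosed_closure⟩ : TopologicalSpace.Closeds F₁)).subschemeι x : F₁)}, hx⟩ : TopologicalSpace.Closeds F₁))
      obtain ⟨F₉, β, T₉, hR, m', hm', hDI'⟩ := hcont F₂ υ hυ
      obtain ⟨F', ρ', T', hQ', hreg'⟩ := ih m' (Nat.lt_succ_of_le hm') F₉ ((β ≫ υ) ≫ ρ) T₉ hDI'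
      refine ⟨F', ρ', T', fun Q hQc hQ => ?_, hreg'⟩
      have hstep := hQc F₁ F₂ ρ T₁ x υ hx hQ hnreg hreg hυ
      exact hQ' Q hQc (hstep.2 F₉ β T₉ hR)

/-- **(B4δ) `hres_of_rounds` — `hres`(ReachToric) FROM A DOWNSTAIRS INVARIANT, PROVED.**  [OURS · L1 W4.5b · pure logic over `rounds_resolve`] -/
theorem hres_of_rounds [IsAlgClosed k] (H : AlgebraicGeometry.Scheme.{0}) (ι : H ⟶ (Literature.AlgebraicGeometry.Motives.projectiveSpace n k).left)
    (DI : ℕ → ∀ F₁ : AlgebraicGeometry.Scheme.{0}, (F₁ ⟶ (Literature.AlgebraicGeometry.Motives.projectiveSpace n k).left) → Set F₁ → Prop)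
    (hinit : ∃ m, DI m (Literature.AlgebraicGeometry.Motives.projectiveSpace n k).left (𝟙 (Literature.AlgebraicGeometry.Motives.projectiveSpace n k).left) (Set.range ι))
    (hend : ∀ (F₁ : AlgebraicGeometry.Scheme.{0}) (ρ : F₁ ⟶ (Literature.AlgebraicGeometry.Motives.projectiveSpace n k).left) (T₁ : Set F₁), DI 0 F₁ ρ T₁ →
      Literature.AlgebraicGeometry.Resolution.Scheme.IsRegular (AlgebraicGeometry.Scheme.IdealSheafData.vanishingIdeal (⟨closure T₁, isClosed_closure⟩ : TopologicalSpace.Closeds F₁)).subscheme)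
    (hround : RoundFacts n k DI) :
    (∃ (F' : AlgebraicGeometry.Scheme.{0}) (ρ' : F' ⟶ (Literature.AlgebraicGeometry.Motives.projectiveSpace n k).left)
        (T' : Set F'),
      (∀ Q : (∀ F₁ : AlgebraicGeometry.Scheme.{0}, (F₁ ⟶ (Literature.AlgebraicGeometry.Motives.projectiveSpace n k).left) →
          Set F₁ → Prop),
        Q (Literature.AlgebraicGeometry.Motives.projectiveSpace n k).left
          (𝟙 (Literature.AlgebraicGeometry.Motives.projectiveSpace n k).left) (Set.range ι) →
        (∀ (F₁ F₂ : AlgebraicGeometry.Scheme.{0}) (ρ : F₁ ⟶ (Literature.AlgebraicGeometry.Motives.projectiveSpace n k).left)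
            (T₁ : Set F₁)
            (x : ↥(AlgebraicGeometry.Scheme.IdealSheafData.vanishingIdeal
              (⟨closure T₁, isClosed_closure⟩ : TopologicalSpace.Closeds F₁)).subscheme)
            (υ : F₂ ⟶ F₁)
            (hx : IsClosed ({((AlgebraicGeometry.Scheme.IdealSheafData.vanishingIdeal
              (⟨closure T₁, isClosed_closure⟩ : TopologicalSpace.Closeds F₁)).subschemeι x : F₁)} : Set F₁)),
          Q F₁ ρ T₁ →
          ¬ IsRegularLocalRing ((AlgebraicGeometry.Scheme.IdealSheafData.vanishingIdeal
              (⟨closure T₁, isClosed_closure⟩ : TopologicalSpace.Closeds F₁)).subscheme.presheaf.stalk x) →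
          IsRegularLocalRing (F₁.presheaf.stalk ((AlgebraicGeometry.Scheme.IdealSheafData.vanishingIdeal
              (⟨closure T₁, isClosed_closure⟩ : TopologicalSpace.Closeds F₁)).subschemeι x)) →
          Literature.AlgebraicGeometry.Resolution.IsBlowup υ
            (AlgebraicGeometry.Scheme.IdealSheafData.vanishingIdeal
              (⟨{((AlgebraicGeometry.Scheme.IdealSheafData.vanishingIdeal
                (⟨closure T₁, isClosed_closure⟩ : TopologicalSpace.Closeds F₁)).subschemeι x : F₁)}, hx⟩ :
                TopologicalSpace.Closeds F₁)) →
          Q F₂ (υ ≫ ρ) (closure (υ ⁻¹' (T₁ \ {((AlgebraicGeometry.Scheme.IdealSheafData.vanishingIdeal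
              (⟨closure T₁, isClosed_closure⟩ : TopologicalSpace.Closeds F₁)).subschemeι x : F₁)}))) ∧
          (∀ (F₉ : AlgebraicGeometry.Scheme.{0}) (β : F₉ ⟶ F₂) (T₉ : Set F₉),
            ReachToric n F₁ F₂ υ ((AlgebraicGeometry.Scheme.IdealSheafData.vanishingIdeal
                (⟨closure T₁, isClosed_closure⟩ : TopologicalSpace.Closeds F₁)).subschemeι x)
              (closure (υ ⁻¹' (T₁ \ {((AlgebraicGeometry.Scheme.IdealSheafData.vanishingIdeal
                (⟨closure T₁, isClosed_closure⟩ : TopologicalSpace.Closeds F₁)).subschemeι x : F₁)}))) F₉ β T₉ →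
            Q F₉ ((β ≫ υ) ≫ ρ) T₉)) →
        Q F' ρ' T') ∧
      Literature.AlgebraicGeometry.Resolution.Scheme.IsRegular (AlgebraicGeometry.Scheme.IdealSheafData.vanishingIdeal
        (⟨closure T', isClosed_closure⟩ : TopologicalSpace.Closeds F')).subscheme) := by
  obtain ⟨m, hm⟩ := hinit
  obtain ⟨F', ρ', T', hQ, hreg⟩ := rounds_resolve n k DI hend hround m _ _ _ hm
  exact ⟨F', ρ', T', fun Q hQ0 hQc => hQ Q hQc hQ0, hreg⟩

end Rounds

end Summit.ResolutionOfSingularities.ResolutionOfSingularities.Cruxes.EquisingularLiftNat.Sections.ND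

end
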